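import Summits.AnomalousDissipation.AnomalousDissipation.Theorems.BaireTransferRobustLoudUpgradeStubLsFoldPeriodic

/-!
# Stub `stub_lsSaddlePeriodic` (crux stmt-AnomalousDissipation-1144, companion c3), part A: lemmas for the INVISIBLE SADDLE OF CYCLES —
# the RESPONSE field of a forced linearised lattice solution realised classically with its multiplier (`responseField`, the forced twin of
# `kernelField`), `g ≠ 0 ≠ ∂ₛx₀` (`phase_ne_zero`), the realisation of the zeros of the Lyapunov–Schmidt function (`zeros_realised`), and the
# derivative of the Lyapunov–Schmidt identities along a general direction `(d', x)` (`ls_deriv_dir`; registered ending `lsSaddlePeriodic_partA`).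
# Pure proof file; notations verbatim from `PeriodicNSOrbitPersistsProofs`.  Refs: Kielhöfer 2012 §I.16; Chow–Hale 1982 Ch. 7; Iooss 1972 §3.
-/


-- `Summit.<Summit>.<Problem>` is the tree's mandated summit-side namespace (CONVENTIONS §2); for this
-- single-conjunct summit the two coincide, so the duplicate is deliberate.
set_option linter.dupNamespace false

noncomputable section

open scoped BigOperators Topology ENNReal NNReal ComplexConjugate
open Filter Set Function MeasureTheory UnitAddTorus

namespace Summit.AnomalousDissipation.AnomalousDissipation.Theorems.RobustLoudUpgrade.LsFamilyPeriodic

open Literature.Analysis.FunctionSpaces Literature.Analysis.FunctionSpaces.Torus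
open Literature.Analysis.FunctionSpaces.EuclideanSpace
open Literature.Analysis.FluidPDE
open Literature.Analysis.FluidPDE.ScalarFourier
open Literature.Analysis.FluidPDE.TimePeriodicLattice
open Summit.AnomalousDissipation.AnomalousDissipation.Theses.BaireTransfer

-- NOTATION START (verbatim from `PeriodicNSOrbitPersistsProofs`)
/-- Local notation: the parabolic weight `Λ(n, k) = |n| + |k|²`. -/
local notation:max "Λ" m:max => (|((Prod.fst m : ℤ) : ℝ)| + freqNormSq (Prod.snd m))

/-- Local notation: the convective symbol on `ℤ × ℤ³` (as in `TimePeriodicNSLattice`). -/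
local notation:max "𝐍[" a ", " b "]" m:max =>
  (WithLp.toLp 2 (fun p : Fin 3 => ∑ j : Fin 3, ∑' m' : ℤ × (Fin 3 → ℤ),
    a m' j * (dsym j (Prod.snd m - Prod.snd m') * b (m - m') p)) : EuclideanSpace ℂ (Fin 3))

/-- Local notation: division by the weight. -/
local notation:max "𝐜" x:max => (fun mm : ℤ × (Fin 3 → ℤ) =>
  ((((|((Prod.fst mm : ℤ) : ℝ)| + freqNormSq (Prod.snd mm))⁻¹ : ℝ) : ℂ) • x mm))

/-- Local notation: multiplication by the weight. -/
local notation:max "𝐬" x:max => (fun mm : ℤ × (Fin 3 → ℤ) =>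
  ((((|((Prod.fst mm : ℤ) : ℝ)| + freqNormSq (Prod.snd mm)) : ℝ) : ℂ) • x mm))

/-- Local notation: the family of coefficients of `x ∈ W ⊂ ℓ²`. -/
local notation:max "𝐰" x:max =>
  (((x : lp (fun _ : ℤ × (Fin 3 → ℤ) => EuclideanSpace ℂ (Fin 3)) 2)) : ℤ × (Fin 3 → ℤ) → EuclideanSpace ℂ (Fin 3))

/-- Local notation: the extension `K ↦ c (K₀, tail K)` of a lattice family to `ℤ⁴`. -/
local notation:max "𝐄" c:max => (fun K : Fin 4 → ℤ => c ((K 0, Fin.tail K) : ℤ × (Fin 3 → ℤ)))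

/-- Local notation: the lattice family `û(n,k) = 𝓕(complexify ∘ (U − m₀))(n,k)`. -/
local notation:max "𝐮[" U ", " m₀ "]" => (fun mm : ℤ × (Fin 3 → ℤ) =>
  mFourierCoeff (EuclideanSpace.complexify ∘ fun y : UnitAddTorus (Fin 4) => U y - m₀)
    (Fin.cons (Prod.fst mm) (Prod.snd mm) : Fin 4 → ℤ))

/-- Local notation: the force family `y_F(n,k) = [k ≠ 0][n = 0] 𝓕(complexify ∘ F)(k)`. -/
local notation:max "𝐲" F:max => (fun mm : ℤ × (Fin 3 → ℤ) =>
  (ite (Prod.snd mm = 0) (0 : EuclideanSpace ℂ (Fin 3))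
    (ite (Prod.fst mm = 0) (mFourierCoeff (EuclideanSpace.complexify ∘ F) (Prod.snd mm)) 0)))

/-- Local notation: the lattice family of the orbit `u` with period `τ`. -/
local notation:max "𝐨[" τ ", " u "]" => (fun mm : ℤ × (Fin 3 → ℤ) =>
  mFourierCoeff (EuclideanSpace.complexify ∘ fun y : UnitAddTorus (Fin 4) => Torus.timeRoll τ u y - ∫ x, u 0 x)
    (Fin.cons (Prod.fst mm) (Prod.snd mm) : Fin 4 → ℤ))
/-- Local notation: the time multiplier `dₛ(n,k) = 2πi n / Λ(n,k)`. -/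
local notation "dS" => (fun mm : ℤ × (Fin 3 → ℤ) =>
  (2 * Real.pi * Complex.I * ((Prod.fst mm : ℤ) : ℂ)) * ((((|((Prod.fst mm : ℤ) : ℝ)| + freqNormSq (Prod.snd mm)) : ℝ) : ℂ))⁻¹)

/-- Local notation: the Stokes–drift multiplier `(4π²ν|k|² + 2πi m₀·k) / Λ(n,k)`. -/
local notation "dL[" ν ", " m₀ "]" => (fun mm : ℤ × (Fin 3 → ℤ) =>
  (((4 * Real.pi ^ 2 * ν * freqNormSq (Prod.snd mm) : ℝ) : ℂ) +
      2 * Real.pi * Complex.I * (∑ jj : Fin 3, ((m₀ jj : ℝ) : ℂ) * (((Prod.snd mm) jj : ℤ) : ℂ))) *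
    ((((|((Prod.fst mm : ℤ) : ℝ)| + freqNormSq (Prod.snd mm)) : ℝ) : ℂ))⁻¹)

/-- Local notation: the symbol `σ_om(n,k) = 2πiomn + 4π²ν|k|² + 2πi m₀·k`. -/
local notation "σ[" om ", " ν ", " m₀ "]" => (fun mm : ℤ × (Fin 3 → ℤ) =>
  2 * Real.pi * Complex.I * ((om : ℝ) : ℂ) * ((Prod.fst mm : ℤ) : ℂ) +
    (((4 * Real.pi ^ 2 * ν * freqNormSq (Prod.snd mm) : ℝ)) : ℂ) +
    2 * Real.pi * Complex.I * (∑ jj : Fin 3, ((m₀ jj : ℝ) : ℂ) * (((Prod.snd mm) jj : ℤ) : ℂ)))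
-- NOTATION END

variable {W : Submodule ℝ (lp (fun _ : ℤ × (Fin 3 → ℤ) => EuclideanSpace ℂ (Fin 3)) 2)}

/-! ## §1 The response field of a forced linearised lattice solution, realised classically with its multiplier -/

section ResponseField

variable {ν τ : ℝ} {f : UnitAddTorus (Fin 3) → EuclideanSpace ℝ (Fin 3)}
  {u : ℝ → UnitAddTorus (Fin 3) → EuclideanSpace ℝ (Fin 3)} {p : ℝ → UnitAddTorus (Fin 3) → ℝ}

variable (hW : ∀ x : lp (fun _ : ℤ × (Fin 3 → ℤ) => EuclideanSpace ℂ (Fin 3)) 2, x ∈ W ↔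
      (∀ n : ℤ, (x : ℤ × (Fin 3 → ℤ) → EuclideanSpace ℂ (Fin 3)) (n, 0) = 0) ∧
      (∀ mm : ℤ × (Fin 3 → ℤ), (∑ jj : Fin 3, ((mm.2 jj : ℤ) : ℂ) *
        ((x : ℤ × (Fin 3 → ℤ) → EuclideanSpace ℂ (Fin 3)) mm) jj) = 0) ∧
      (∀ mm : ℤ × (Fin 3 → ℤ), (x : ℤ × (Fin 3 → ℤ) → EuclideanSpace ℂ (Fin 3)) (-mm) =
        conjVec ((x : ℤ × (Fin 3 → ℤ) → EuclideanSpace ℂ (Fin 3)) mm)))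
variable {Ds L₀ : W →L[ℝ] W} (hDs : ∀ (x : W) (m : ℤ × (Fin 3 → ℤ)), (𝐰 (Ds x)) m = dS m • (𝐰 x) m)
  (hL₀ : ∀ (x : W) (m : ℤ × (Fin 3 → ℤ)), (𝐰 (L₀ x)) m = dL[ν, ∫ x, u 0 x] m • (𝐰 x) m)
variable {B : W → W → W} (hBf : ∀ (x y : W) (m : ℤ × (Fin 3 → ℤ)), (𝐰 (B x y)) m = Torus.lerayCoeff m.2 (𝐍[𝐜 (𝐰 x), 𝐜 (𝐰 y)] m))


include hW hDs hL₀ hBf in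
/-- **The response field, realised classically with its multiplier** (forced twin of `kernelField`, explicit form of `forced_classical`).
A lattice solution `k ∈ W` of `T k + μ ∂ₛx₀ = Y_H` (`T = τ⁻¹∂ₛ + L₀ + B(x₀,·) + B(·,x₀)`, `Y_H` the coefficient vector of a real admissible
`τ`-periodic field `H`) is the weighted family of a REAL smooth `τ`-periodic field on `ℝ × T³` — the unrolling of `Re F_{k/Λ}` — which solves
the linearised problem forced by `(−μτ) ∂ₜu + H`; its coefficient family is `k/Λ`. [folklore] -/
theorem responseField (hν : 0 < ν) (hτ : 0 < τ) (hsol : Torus.IsClassicalNSSolutionOn univ ν (fun _ => f) u p)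
    (hper : Function.Periodic u τ) (hf0 : HasZeroMean f) (x₀ : W) (hx₀ : 𝐰 x₀ = 𝐬 (𝐨[τ, u]))
    {H : ℝ → UnitAddTorus (Fin 3) → EuclideanSpace ℝ (Fin 3)} (hH : IsSmoothSpaceTimeOn univ H) (hHper : Function.Periodic H τ)
    (hHdiv : ∀ t, IsDivFree (H t)) (hH0 : ∀ t, HasZeroMean (H t)) (YH : W) (hYH : 𝐰 YH = 𝐮[timeRoll τ H, 0])
    (k : W) (μ : ℝ) (heqW : τ⁻¹ • Ds k + L₀ k + (B x₀ k + B k x₀) = (-μ) • Ds x₀ + YH) :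
    RapidDecay (𝐄 (𝐜 (𝐰 k))) ∧
    IsSmooth (fun y : UnitAddTorus (Fin 4) => EuclideanSpace.realPart (fourierSynth (𝐄 (𝐜 (𝐰 k))) y)) ∧
    (complexify ∘ fun y : UnitAddTorus (Fin 4) => EuclideanSpace.realPart (fourierSynth (𝐄 (𝐜 (𝐰 k))) y)) = fourierSynth (𝐄 (𝐜 (𝐰 k))) ∧
    (∀ m : ℤ × (Fin 3 → ℤ), mFourierCoeff (complexify ∘ fun y : UnitAddTorus (Fin 4) =>
        EuclideanSpace.realPart (fourierSynth (𝐄 (𝐜 (𝐰 k))) y)) (Fin.cons m.1 m.2) = (𝐜 (𝐰 k)) m) ∧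
    IsSmoothSpaceTimeOn univ (fun t : ℝ => fun x : UnitAddTorus (Fin 3) =>
        EuclideanSpace.realPart (fourierSynth (𝐄 (𝐜 (𝐰 k))) (Fin.cons (((τ⁻¹ * t : ℝ)) : UnitAddCircle) x))) ∧
    Function.Periodic (fun t : ℝ => fun x : UnitAddTorus (Fin 3) =>
        EuclideanSpace.realPart (fourierSynth (𝐄 (𝐜 (𝐰 k))) (Fin.cons (((τ⁻¹ * t : ℝ)) : UnitAddCircle) x))) τ ∧
    (fun t : ℝ => fun x : UnitAddTorus (Fin 3) => Torus.realToComplex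
        (EuclideanSpace.realPart (fourierSynth (𝐄 (𝐜 (𝐰 k))) (Fin.cons (((τ⁻¹ * t : ℝ)) : UnitAddCircle) x)))) ∈
      linPeriodicSol ν u τ (fun t x => ((((-μ : ℝ) : ℂ) * (τ : ℂ))) • velocityDot u t x + Torus.realToComplex (H t x)) := by
  have hU : IsSmooth (timeRoll τ u) := orbit_isSmooth hsol hper
  have hu0 := orbit_zero_modes hsol hper hf0
  have hut := orbit_transversal hsol hper
  obtain ⟨hHz, hHt, -, hHr⟩ := fieldFamily_admissible (τ := τ) (Z := H) hH hHper hHdiv hH0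
  have hVH : IsSmooth (timeRoll τ H) := isSmooth_timeRoll hH hHper
  have hHc : IsSmooth (complexify ∘ fun y => timeRoll τ H y - 0) :=
    (hVH.sub (isSmooth_const _)).comp_clm complexify.toContinuousLinearMap
  have hyH : ∀ N : ℕ, ∑' m : ℤ × (Fin 3 → ℤ), ENNReal.ofReal ((Λ m) ^ N) * ‖(𝐮[timeRoll τ H, 0]) m‖ₑ ^ 2 ≠ ⊤ := by
    intro N
    have h1 := moments_of_rapidDecay (C := mFourierCoeff (complexify ∘ fun y => timeRoll τ H y - 0)) hHr N
    exact ne_top_of_le_ne_top h1 (ENNReal.tsum_le_tsum fun m => by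
      gcongr; exact enorm_le_enorm_sw (x := 𝐮[timeRoll τ H, 0]) hHz m)
  have hY : ∀ m, (𝐰 (((-μ) • Ds x₀ + YH : W))) m =
      ((-μ : ℝ) : ℂ) • ((2 * Real.pi * Complex.I * (m.1 : ℂ)) • 𝐨[τ, u] m) + 𝐮[timeRoll τ H, 0] m := fun m => by
    rw [coeW_add, Pi.add_apply, coe_smul_Ds_orbit hDs hsol hper hf0 x₀ hx₀ (-μ) m, hYH, Complex.ofReal_neg]
  obtain ⟨heq, hhr⟩ := linear_core_forced hW hDs hL₀ hBf hν hτ hsol hper hf0 x₀ hx₀ k ((-μ) • Ds x₀ + YH)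
    (b := ((-μ : ℝ) : ℂ)) (yH := 𝐮[timeRoll τ H, 0]) hyH hY heqW
  have hh0 : ∀ n : ℤ, (𝐜 (𝐰 k)) (n, 0) = 0 := cw_zero_mode (W_zero hW k)
  have hht : ∀ mm : ℤ × (Fin 3 → ℤ), (∑ jj : Fin 3, ((mm.2 jj : ℤ) : ℂ) * ((𝐜 (𝐰 k)) mm) jj) = 0 := cw_transversal (W_trans hW k)
  have hcs : ∀ mm : ℤ × (Fin 3 → ℤ), (𝐜 (𝐰 k)) (-mm) = conjVec ((𝐜 (𝐰 k)) mm) := cw_neg (W_conj hW k)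
  have heq' : ∀ m : ℤ × (Fin 3 → ℤ), m.2 ≠ 0 →
      (2 * Real.pi * Complex.I * ((τ⁻¹ : ℝ) : ℂ) * (m.1 : ℂ) + ((4 * Real.pi ^ 2 * ν * freqNormSq m.2 : ℝ) : ℂ) +
          2 * Real.pi * Complex.I * (∑ jj : Fin 3, ((((∫ x, u 0 x) : EuclideanSpace ℝ (Fin 3)) jj : ℝ) : ℂ) * ((m.2 jj : ℤ) : ℂ))) •
          (𝐜 (𝐰 k)) m +
        Torus.lerayCoeff m.2 (𝐍[𝐨[τ, u], 𝐜 (𝐰 k)] m + 𝐍[𝐜 (𝐰 k), 𝐨[τ, u]] m) =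
        ((-μ : ℝ) : ℂ) • ((2 * Real.pi * Complex.I * (m.1 : ℂ)) • 𝐨[τ, u] m) +
          Torus.lerayCoeff m.2 (mFourierCoeff (complexify ∘ fun y => timeRoll τ H y - 0) (Fin.cons m.1 m.2)) := by
    intro m hm
    rw [heq m hm, SteadyLattice.lerayCoeff_of_kdot_eq_zero hm (hHt m)]
  have hH0' : ∀ n : ℤ, mFourierCoeff (complexify ∘ fun y => timeRoll τ H y - 0) (Fin.cons n (0 : Fin 3 → ℤ)) = 0 := fun n => hHz n
  obtain ⟨Q, hQ, hE⟩ := linear_rolledUp_of_coeff_forced (U := timeRoll τ u) (m₀ := ∫ x, u 0 x) (h := 𝐜 (𝐰 k))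
    (b := ((-μ : ℝ) : ℂ)) (Hc := complexify ∘ fun y => timeRoll τ H y - 0) hU hu0 hut hh0 hht hhr hHc hH0' heq'
  obtain ⟨hsw, hsq, hdivC, hmeanC, hperw, hEq⟩ := linear_classical_forced (ν := ν) hτ hsol.smooth_velocity hper
    hhr.isSmooth_fourierSynth hQ hE (div_synth_eq_zero (h := 𝐜 (𝐰 k)) hht hhr)
    (integral_timeSlice_synth_eq_zero (h := 𝐜 (𝐰 k)) hh0 hhr)
  obtain ⟨hV's, hreal, hVcoef⟩ := realSynth_spec' hhr (ext_neg_eq_conjVec (c := 𝐜 (𝐰 k)) hcs)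
  have hfun : (fun t : ℝ => fun x : UnitAddTorus (Fin 3) => Torus.realToComplex
      (EuclideanSpace.realPart (fourierSynth (𝐄 (𝐜 (𝐰 k))) (Fin.cons (((τ⁻¹ * t : ℝ)) : UnitAddCircle) x)))) =
      fun t : ℝ => fun x : UnitAddTorus (Fin 3) => fourierSynth (𝐄 (𝐜 (𝐰 k))) (Fin.cons (((τ⁻¹ * t : ℝ)) : UnitAddCircle) x) := by
    funext t x
    have := congrArg (fun F : UnitAddTorus (Fin 4) → EuclideanSpace ℂ (Fin 3) => F (Fin.cons (((τ⁻¹ * t : ℝ)) : UnitAddCircle) x)) hreal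
    simp only [Function.comp_apply] at this
    rw [SteadyLattice.realToComplex_eq_complexify]
    exact this
  refine ⟨hhr, hV's, hreal, fun m => ?_, ?_, ?_, ?_⟩
  · rw [hVcoef]
    simp only [Fin.cons_zero, Fin.tail_cons, Prod.mk.eta]
  · have h1 := isSmoothSpaceTimeOn_cons hV's τ⁻¹
    exact h1
  · have h1 := periodic_comp_cons (fun y : UnitAddTorus (Fin 4) => EuclideanSpace.realPart (fourierSynth (𝐄 (𝐜 (𝐰 k))) y))
      (inv_ne_zero hτ.ne')
    rw [inv_inv] at h1
    exact h1
  · rw [hfun]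
    refine ⟨hsw, hdivC, hmeanC, hperw, _, hsq, fun t x => ?_⟩
    show _ = _ + ((((-μ : ℝ) : ℂ) * (τ : ℂ)) • velocityDot u t x + Torus.realToComplex (H t x))
    rw [hEq t x, Function.comp_apply, timeRoll_cons hHper, sub_zero, show τ * (τ⁻¹ * t) = t by field_simp,
      SteadyLattice.realToComplex_eq_complexify (H t x), add_assoc]
    rfl


include hDs in
/-- **`g ≠ 0` and `∂ₛx₀ ≠ 0`** for a genuinely time-dependent orbit: the phase vector `g = (2πi n) x₀` and `Dₛ x₀` do not vanish (else the
family `(2πi n) û` would vanish, contradicting `eq_zero_of_lincomb_family_eq_zero`). [folklore] -/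
theorem phase_ne_zero (hτ : 0 < τ) (hsol : Torus.IsClassicalNSSolutionOn univ ν (fun _ => f) u p) (hper : Function.Periodic u τ)
    (hf0 : HasZeroMean f) (hmov : ∃ t x, Torus.timeDerivWithin univ u t x ≠ 0)
    {v : ℝ → UnitAddTorus (Fin 3) → EuclideanSpace ℝ (Fin 3)} (hsv : IsSmoothSpaceTimeOn univ v) (hperv : Function.Periodic v τ)
    (hdeg : ¬ ∃ z : ℂ, ∀ t x, Torus.realToComplex (v t x) = z • velocityDot u t x)
    (x₀ : W) (hx₀ : 𝐰 x₀ = 𝐬 (𝐨[τ, u])) (g : W)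
    (hg : 𝐰 g = fun mm : ℤ × (Fin 3 → ℤ) => (2 * Real.pi * Complex.I * (mm.1 : ℂ)) • (𝐬 (𝐨[τ, u])) mm) :
    g ≠ 0 ∧ Ds x₀ ≠ 0 := by
  have hu0 := orbit_zero_modes hsol hper hf0
  have hfam0 : ¬ ∀ m : ℤ × (Fin 3 → ℤ), (2 * Real.pi * Complex.I * (m.1 : ℂ)) • 𝐨[τ, u] m = 0 := by
    intro hall
    have hfam : ∀ m : ℤ × (Fin 3 → ℤ), (1 : ℂ) • ((2 * Real.pi * Complex.I * (m.1 : ℂ)) • 𝐨[τ, u] m) +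
        (0 : ℂ) • 𝐮[timeRoll τ v, 0] m = 0 := fun m => by rw [hall m, smul_zero, zero_smul, add_zero]
    exact one_ne_zero (eq_zero_of_lincomb_family_eq_zero (u := u) (v := v) hτ hsol.smooth_velocity hper hsv hperv
      (∫ x, u 0 x) hmov hdeg hfam).1
  have hsmul_zero_iff : ∀ m : ℤ × (Fin 3 → ℤ), (2 * Real.pi * Complex.I * (m.1 : ℂ)) • (𝐬 (𝐨[τ, u])) m = 0 →
      (2 * Real.pi * Complex.I * (m.1 : ℂ)) • 𝐨[τ, u] m = 0 := by
    intro m hm0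
    by_cases hm : m.2 = 0
    · have h0 : 𝐨[τ, u] m = 0 := by
        have := hu0 m.1; rwa [show ((m.1, 0) : ℤ × (Fin 3 → ℤ)) = m from Prod.ext rfl hm.symm] at this
      rw [h0, smul_zero]
    · have hL : ((((Λ m)) : ℝ) : ℂ) ≠ 0 := by exact_mod_cast ne_of_gt (lt_of_lt_of_le one_pos (one_le_wt hm))
      simp only [smul_smul] at hm0
      rw [mul_comm, ← smul_smul, smul_eq_zero] at hm0
      rcases hm0 with h1 | h1
      · exact absurd h1 hL
      · exact h1
  refine ⟨fun hg0 => ?_, fun hD0 => ?_⟩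
  · refine hfam0 fun m => hsmul_zero_iff m ?_
    have h1 := congrArg (fun z : W => (𝐰 z) m) hg0
    simp only at h1
    rw [hg, coeW_zero, Pi.zero_apply] at h1
    exact h1
  · refine hfam0 fun m => ?_
    have h1 := congrArg (fun z : W => (𝐰 z) m) hD0
    simp only at h1
    have h2 := coe_smul_Ds_orbit hDs hsol hper hf0 x₀ hx₀ 1 m
    rw [one_smul, h1, coeW_zero, Pi.zero_apply, Complex.ofReal_one, one_smul] at h2
    exact h2.symm

include hW hDs hL₀ hBf in
/-- **Zeros of the Lyapunov–Schmidt function are periodic orbits of the uncorrected forces, uniformly close to `u`** (the realisation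
clause of `robustCrossingPeriodic`, for ANY continuous family `υ` through `(x₀, τ⁻¹)` whose values at the zeros of `σ` solve the lattice
equation of the force `q.1`). [folklore] -/
theorem zeros_realised {S : Finset (Fin 3 → ℤ)} (hν : 0 < ν) (hτ : 0 < τ)
    (hsol : Torus.IsClassicalNSSolutionOn univ ν (fun _ => f) u p) (hper : Function.Periodic u τ) (hf0 : HasZeroMean f)
    (x₀ : W) (hx₀ : 𝐰 x₀ = 𝐬 (𝐨[τ, u])) (Fm : Coeff S →L[ℝ] W) (hFm : ∀ c : Coeff S, 𝐰 (Fm c) = 𝐲 (force S c))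
    (υ : Coeff S × ℝ → W × ℝ) (σ : Coeff S × ℝ → ℝ) (c : Coeff S) (r : ℝ) (hr : 0 < r) (hυ0 : υ (c, 0) = (x₀, τ⁻¹))
    (hυc : ContinuousOn υ (Metric.ball ((c, 0) : Coeff S × ℝ) r)) (hσc : ContinuousOn σ (Metric.ball ((c, 0) : Coeff S × ℝ) r))
    (hzero : ∀ q ∈ Metric.ball ((c, 0) : Coeff S × ℝ) r, σ q = 0 →
      (υ q).2 • Ds (υ q).1 + L₀ (υ q).1 + B (υ q).1 (υ q).1 = Fm q.1) :
    ∀ δ : ℝ, 0 < δ → ∃ r' : ℝ, 0 < r' ∧ ContinuousOn σ (Metric.ball (c, (0 : ℝ)) r') ∧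
      ∀ q ∈ Metric.ball (c, (0 : ℝ)) r', σ q = 0 → ∃ (τ' : ℝ) (u' : ℝ → UnitAddTorus (Fin 3) → EuclideanSpace ℝ (Fin 3))
        (p' : ℝ → UnitAddTorus (Fin 3) → ℝ), 0 < τ' ∧ Torus.IsClassicalNSSolutionOn univ ν (fun _ => force S q.1) u' p' ∧
        Function.Periodic u' τ' ∧ ∀ t, (∫ x, ‖u' t x - u (τ / τ' * t) x‖ ^ 2) + gradNormSq (fun x => u' t x - u (τ / τ' * t) x) ≤ δ := by
  intro δ hδ
  obtain ⟨ε, hε⟩ : ∃ ε : ℝ, ε = Real.sqrt (δ / (3 * (1 + 4 * Real.pi ^ 2))) := ⟨_, rfl⟩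
  have hε0 : 0 < ε := by rw [hε]; exact Real.sqrt_pos.2 (by positivity)
  have hε2 : 3 * (1 + 4 * Real.pi ^ 2) * ε ^ 2 = δ := by rw [hε, Real.sq_sqrt (by positivity)]; field_simp
  obtain ⟨δ₁, hδ₁⟩ : ∃ δ₁ : ℝ, δ₁ = min (τ⁻¹ / 2) ε := ⟨_, rfl⟩
  have hδ₁0 : 0 < δ₁ := by rw [hδ₁]; exact lt_min (by positivity) hε0
  have hδ₁τ : δ₁ ≤ τ⁻¹ / 2 := by rw [hδ₁]; exact min_le_left _ _
  have hδ₁ε : δ₁ ≤ ε := by rw [hδ₁]; exact min_le_right _ _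
  have hball : Metric.ball ((c, (0 : ℝ)) : Coeff S × ℝ) r ∈ 𝓝 ((c, (0 : ℝ)) : Coeff S × ℝ) :=
    Metric.isOpen_ball.mem_nhds (Metric.mem_ball_self hr)
  have hυa : ContinuousAt υ (c, 0) := (hυc (c, 0) (Metric.mem_ball_self hr)).continuousAt hball
  obtain ⟨r₁, hr₁, hυr₁⟩ := Metric.continuousAt_iff.1 hυa δ₁ hδ₁0
  refine ⟨min r r₁, lt_min hr hr₁, hσc.mono (Metric.ball_subset_ball (min_le_left _ _)), fun q hq hσq => ?_⟩
  have hqr : q ∈ Metric.ball ((c, (0 : ℝ)) : Coeff S × ℝ) r := Metric.ball_subset_ball (min_le_left _ _) hq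
  have hq₁ : dist q (c, 0) < r₁ := lt_of_lt_of_le (Metric.mem_ball.1 hq) (min_le_right _ _)
  have hυq := hυr₁ hq₁
  rw [hυ0] at hυq
  have hGx' := hzero q hqr hσq
  rcases hxq : υ q with ⟨x, om⟩
  rw [hxq] at hGx' hυq
  have hGx : om • Ds x + L₀ x + B x x = Fm q.1 := hGx'
  have hdx : ‖x - x₀‖ < δ₁ := by
    have h1 : dist x x₀ ≤ dist (x, om) (x₀, τ⁻¹) := by rw [Prod.dist_eq]; exact le_max_left _ _
    rw [dist_eq_norm] at h1
    exact lt_of_le_of_lt h1 hυq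
  have hdom : |om - τ⁻¹| < δ₁ := by
    have h1 : dist om τ⁻¹ ≤ dist (x, om) (x₀, τ⁻¹) := by rw [Prod.dist_eq]; exact le_max_right _ _
    rw [Real.dist_eq] at h1
    exact lt_of_le_of_lt h1 hυq
  have hom : 0 < om := by
    have h1 := (abs_lt.1 hdom).1
    have h3 : 0 < τ⁻¹ := inv_pos.2 hτ
    linarith only [h1, h3, hδ₁τ]
  obtain ⟨p', hsol', hper', hclose⟩ := witness_of_latticeSol hW hDs hL₀ hBf hν hsol hper hf0 x₀ hx₀ x hom
    (SteadyPersist.isSmooth_force' q.1) (SteadyPersist.isDivFree_force' q.1) (SteadyPersist.hasZeroMean_force' q.1)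
    (Fm q.1) (hFm q.1) hGx
  refine ⟨om⁻¹, _, p', inv_pos.2 hom, hsol', hper', fun t => ?_⟩
  have hxx : ‖x - x₀‖ ^ 2 ≤ ε ^ 2 := by
    have := hdx.le.trans hδ₁ε
    exact pow_le_pow_left₀ (norm_nonneg _) this 2
  calc _ ≤ (3 * (1 + 4 * Real.pi ^ 2)) * ‖x - x₀‖ ^ 2 := hclose t
    _ ≤ (3 * (1 + 4 * Real.pi ^ 2)) * ε ^ 2 := by gcongr
    _ = δ := hε2

end ResponseField

/-! ## §2 The derivative of the Lyapunov–Schmidt identities along a general direction -/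

section Abstract

/-- Differentiating the Lyapunov–Schmidt identities `N (υ q) + frc q.1 − σ q • e = 0`, `φ₂ (υ q − u₀) = q.2` at `q = (c, 0)` along a
GENERAL direction `(d', x)`: `T (Dυ (d', x)) + frc d' = ℓ (d', x) • e` and `φ₂ (Dυ (d', x)) = x`. [folklore] -/
theorem ls_deriv_dir {X Y P : Type*} [NormedAddCommGroup X] [NormedSpace ℝ X] [NormedAddCommGroup Y] [NormedSpace ℝ Y]
    [NormedAddCommGroup P] [NormedSpace ℝ P] (N : X → Y) (T : X →L[ℝ] Y) (frc : P →L[ℝ] Y) (e : Y) (φ₂ : X →L[ℝ] ℝ)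
    (σ : P × ℝ → ℝ) (υ : P × ℝ → X) (ℓ : P × ℝ →L[ℝ] ℝ) (Dυ : P × ℝ →L[ℝ] X) (u₀ : X) (c : P) (r : ℝ)
    (hN : HasFDerivAt N T u₀) (hυ0 : υ (c, 0) = u₀) (hσ : HasFDerivAt σ ℓ (c, 0)) (hυ : HasFDerivAt υ Dυ (c, 0)) (hr : 0 < r)
    (hsol : ∀ q ∈ Metric.ball ((c, 0) : P × ℝ) r, N (υ q) + frc q.1 - σ q • e = 0 ∧ φ₂ (υ q - u₀) = q.2) (d' : P) (x : ℝ) :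
    T (Dυ (d', x)) + frc d' = ℓ (d', x) • e ∧ φ₂ (Dυ (d', x)) = x := by
  have hball : Metric.ball ((c, 0) : P × ℝ) r ∈ 𝓝 ((c, 0) : P × ℝ) := Metric.isOpen_ball.mem_nhds (Metric.mem_ball_self hr)
  have hF : HasFDerivAt (fun q : P × ℝ => N (υ q) + frc q.1 - σ q • e)
      (T.comp Dυ + frc.comp (ContinuousLinearMap.fst ℝ P ℝ) - ℓ.smulRight e) (c, 0) := by
    have h1 : HasFDerivAt (fun q : P × ℝ => N (υ q)) (T.comp Dυ) (c, 0) := by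
      have hN' : HasFDerivAt N T (υ (c, 0)) := by rw [hυ0]; exact hN
      exact hN'.comp (c, 0) hυ
    have h2 : HasFDerivAt (fun q : P × ℝ => frc q.1) (frc.comp (ContinuousLinearMap.fst ℝ P ℝ)) (c, 0) :=
      frc.hasFDerivAt.comp (c, 0) hasFDerivAt_fst
    have h3 : HasFDerivAt (fun q : P × ℝ => σ q • e) (ℓ.smulRight e) (c, 0) := hσ.smul_const e
    exact (h1.add h2).sub h3
  have hF0 : HasFDerivAt (fun q : P × ℝ => N (υ q) + frc q.1 - σ q • e) (0 : P × ℝ →L[ℝ] Y) (c, 0) := by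
    refine (hasFDerivAt_const (0 : Y) ((c, 0) : P × ℝ)).congr_of_eventuallyEq ?_
    filter_upwards [hball] with q hq
    exact (hsol q hq).1
  have hD := hF.unique hF0
  have h1 := DFunLike.congr_fun hD ((d' : P), (x : ℝ))
  simp only [sub_apply, add_apply, ContinuousLinearMap.comp_apply,
    ContinuousLinearMap.coe_fst', ContinuousLinearMap.smulRight_apply, zero_apply, sub_eq_zero] at h1
  have hG : HasFDerivAt (fun q : P × ℝ => φ₂ (υ q - u₀)) (φ₂.comp Dυ) (c, 0) := by
    have ha : HasFDerivAt (fun q : P × ℝ => υ q - u₀) Dυ (c, 0) := hυ.sub_const u₀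
    exact φ₂.hasFDerivAt.comp (c, 0) ha
  have hG0 : HasFDerivAt (fun q : P × ℝ => φ₂ (υ q - u₀)) (ContinuousLinearMap.snd ℝ P ℝ) (c, 0) := by
    refine (hasFDerivAt_snd (𝕜 := ℝ) (E := P) (F := ℝ) (p := ((c, 0) : P × ℝ))).congr_of_eventuallyEq ?_
    filter_upwards [hball] with q hq
    exact (hsol q hq).2
  have hD2 := hG.unique hG0
  have h2 := DFunLike.congr_fun hD2 ((d' : P), (x : ℝ))
  simp only [ContinuousLinearMap.comp_apply, ContinuousLinearMap.coe_snd'] at h2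
  exact ⟨h1, h2⟩

/-- **Registered sub-goal `lsSaddlePeriodic_partA`** (companion c3): the derivative of the Lyapunov–Schmidt identities along a general
direction `(d', x)` — `ls_deriv_dir` in Pi-form. [folklore] -/
theorem lsSaddlePeriodic_partA : ∀ (X Y P : Type) [NormedAddCommGroup X] [NormedSpace ℝ X] [NormedAddCommGroup Y] [NormedSpace ℝ Y] [NormedAddCommGroup P] [NormedSpace ℝ P] (N : X → Y) (T : X →L[ℝ] Y) (frc : P →L[ℝ] Y) (e : Y) (φ₂ : X →L[ℝ] ℝ) (σ : P × ℝ → ℝ) (υ : P × ℝ → X) (ℓ : P × ℝ →L[ℝ] ℝ) (Dυ : P × ℝ →L[ℝ] X) (u₀ : X) (c : P) (r : ℝ), HasFDerivAt N T u₀ → υ (c, 0) = u₀ → HasFDerivAt σ ℓ (c, 0) → HasFDerivAt υ Dυ (c, 0) → 0 < r → (∀ q ∈ Metric.ball ((c, 0) : P × ℝ) r, N (υ q) + frc q.1 - σ q • e = 0 ∧ φ₂ (υ q - u₀) = q.2) → ∀ (d' : P) (x : ℝ), T (Dυ (d', x)) + frc d' = ℓ (d', x) • e ∧ φ₂ (Dυ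 (d', x)) = x :=
  fun _ _ _ _ _ _ _ _ _ N T frc e φ₂ σ υ ℓ Dυ u₀ c r hN hυ0 hσ hυ hr hsol d' x =>
    ls_deriv_dir N T frc e φ₂ σ υ ℓ Dυ u₀ c r hN hυ0 hσ hυ hr hsol d' x

end Abstract

end Summit.AnomalousDissipation.AnomalousDissipation.Theorems.RobustLoudUpgrade.LsFamilyPeriodic

end
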